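import Summits.CriticalPhenomena.PercolationContinuityZ3.Theorems.PercNearOneGluingNoHeavyLowerTailKnQuestion8CoefficientwiseCoreClassKernelMixHubBundleMain
import Summits.CriticalPhenomena.PercolationContinuityZ3.Theorems.PercNearOneGluingNoHeavyLowerTailKnQuestion8CoefficientwiseCoreClassKernelMixBundleWords
import HarnessLib

/-!
# The cluster-form dictionary and the HE PURE LEMMA in cluster language on every explicit bundle (all monotone 0/1 levels)

Support file (`--supports stmt-CriticalPhenomena-4575`, closed), prover `prim-cplus-coupling` (gen 52).  No definitions, no notations,
no named facts, no sorries; standard axioms.  Memo `prim-cplus-coupling/A5-COUPLING-gen52.md` §4(1); memo-51 §7(2) ('cluster form').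

An explicit bundle as in `…KernelMixBundleTraces/…BundleWords` (`r` threads `w t 0 = u, …, w t (L t) = b`, edges `e t j`, threads meeting only at the
hubs, `E` = all thread edges) and the word-form data of `…KernelMixHubBundleMain` with `ℓ := L` (index words `⊆ Ẽ r`, thread words `θ`, walls,
runs, traces `TX`/`TY`).  The INDEX WORD of a colouring `ω ⊆ E` is `ω̃ = {(t,k) ∈ Ẽ r : e t k ∈ ω}` (hypothesis `hω̃`).
* `hubB_cluster_run_iff` — `e t 1, …, e t j ∈ ω ⟺ j ≤ ri_t(ω̃)` and `e t (j+1), …, e t (L t) ∈ ω ⟺ L t − rj_t(ω̃) ≤ j` (wall-formula runs = colour runs);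
* `hubB_cluster_eq_trace` — **DICTIONARY**: `v ∈ C_u(ω) ⟺ v = w t k` for some `(t,k) ∈ TX false r ω̃` (exact traces of …BundleWords + the run specs);
  in particular `b ∈ C_u(ω) ⟺ ∃ t < r, (t, L t) ∈ TX false r ω̃` (`hubB_cluster_b_mem_iff`).
The blue cluster `C_u(E ∖ ω)` is the same statement for the complementary colouring, whose index word is `Ẽ r ∖ ω̃`, so that
`hubB_trace_compl` turns it into `TY false r ω̃`.
* **THEOREM `bundle_HEpure_cluster` (HE PURE LEMMA in cluster language, every bundle, ALL monotone 0/1 levels).**  Levels: monotone predicates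
  `hᵃ, hᵇ, kᵃ, kᵇ : Set V → Prop` (arbitrary, not thread-supported); `X = C_u(ω)`, `Y = C_u(E ∖ ω)`;
  `bad₁(ω) :⟺ b ∉ X, b ∈ Y, hᵃ X, ¬hᵇ Y, kᵇ Y, ¬kᵃ X`,  `L₁(ω) :⟺ b ∈ X, b ∉ Y, hᵃ X, ¬hᵇ Y, kᵇ X, ¬kᵃ Y`; for every ⊆-up-closed event `𝒱`:
  `#{ω ⊆ E : 𝒱 ω ∧ bad₁ ω} ≤ #{ω ⊆ E : 𝒱 ω ∧ L₁ ω}` — transport along the index-word bijection + `hubBundle_HEpure`.  The single-type half of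
  LP1(Θ)/IET(Θ) for GENERAL levels (memo-50 §2.3(a)); before, only thread-supported levels were covered (`iet_bundle_threadSupported`); the two-type
  statement (targets `L₁ ∪ L₂ ∪ P₁`) is open (memo-52 §3).  Extra hypotheses `heE` (thread edges lie in `E`) and `heinj` (`e` injective on thread
  positions) hold on every bundle.
[cite: KozmaNitzan2024, Questions 8–9 (§5.5 p. 36) (context); Harris 1960]
-/

namespace Summit.CriticalPhenomena.PercolationContinuityZ3.Theorems

open Finset Literature.Probability.Percolation
open scoped symmDiff

namespace Coefficientwise

variable {ι V : Type*}

/-- **Colour runs = wall-formula runs.**  For the thread word `η = θ t ω̃` of the index word of `ω`: the leading red run condition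
`e t 1..e t j ∈ ω` is `j ≤ ri η`, the trailing one `e t (j+1)..e t (L t) ∈ ω` is `L t − rj η ≤ j` (`j ≤ L t`). [folklore] -/
theorem hubB_cluster_run_iff (L : ℕ → ℕ) (hL : ∀ t, 1 ≤ L t) (r : ℕ) (e : ℕ → ℕ → ι)
    (Et : ℕ → Finset (ℕ × ℕ)) (hEt : ∀ n p, p ∈ Et n ↔ p.1 < n ∧ 1 ≤ p.2 ∧ p.2 ≤ L p.1)
    (θ : ℕ → Finset (ℕ × ℕ) → Finset ℕ) (hθ : ∀ t ω k, k ∈ θ t ω ↔ (t, k) ∈ ω)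
    (D : ℕ → Finset ℕ → Finset ℕ) (hD : ∀ t η, D t η = (Icc 1 (L t - 1)).filter (fun k => ¬ (k ∈ η ↔ k + 1 ∈ η)))
    (ri rj : ℕ → Finset ℕ → ℕ)
    (hri : ∀ t η, ri t η = if 1 ∈ η then (if h : (D t η).Nonempty then (D t η).min' h else L t) else 0)
    (hrj : ∀ t η, rj t η = if L t ∈ η then (if h : (D t η).Nonempty then L t - (D t η).max' h else L t) else 0)
    (ω : Finset ι) (ωt : Finset (ℕ × ℕ)) (hωt : ∀ p, p ∈ ωt ↔ p ∈ Et r ∧ e p.1 p.2 ∈ ω)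
    (t : ℕ) (ht : t < r) (j : ℕ) (hj : j ≤ L t) :
    ((∀ j', 1 ≤ j' → j' ≤ j → e t j' ∈ ω) ↔ j ≤ ri t (θ t ωt)) ∧
    ((∀ j', j < j' → j' ≤ L t → e t j' ∈ ω) ↔ L t - rj t (θ t ωt) ≤ j) := by
  have hmem : ∀ k, 1 ≤ k → k ≤ L t → (k ∈ θ t ωt ↔ e t k ∈ ω) := by
    intro k hk1 hk2
    rw [hθ, hωt, hEt]
    exact ⟨fun h => h.2, fun h => ⟨⟨ht, hk1, hk2⟩, h⟩⟩
  have si := hubPath_ri_spec (L t) (hL t) (D t) (hD t) (ri t) (hri t) (θ t ωt)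
  have sj := hubPath_rj_spec (L t) (hL t) (D t) (hD t) (rj t) (hrj t) (θ t ωt)
  constructor
  · constructor
    · intro hrun
      by_contra hlt
      rcases si.2.2 with h | h
      · omega
      · exact h ((hmem _ (by omega) (by omega)).mpr (hrun _ (by omega) (by omega)))
    · intro hle j' h1 h2
      exact (hmem j' h1 (by omega)).mp (si.1 (Finset.mem_Icc.mpr ⟨h1, by omega⟩))
  · constructor
    · intro hrun
      by_contra hlt
      rcases sj.2.2 with h | h
      · omega
      · exact h ((hmem _ (by omega) (by omega)).mpr (hrun _ (by omega) (by omega)))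
    · intro hle j' h1 h2
      exact (hmem j' (by omega) h2).mp (sj.1 (Finset.mem_Icc.mpr ⟨by omega, h2⟩))

open Classical in
/-- **DICTIONARY: the red cluster of `u` on an explicit bundle is the image of the word-form red trace.**
`v ∈ C_u(ω) ⟺ ∃ (t,k) ∈ TX false r ω̃, w t k = v` (`r ≥ 1`, `ω ⊆ E`). [folklore] -/
theorem hubB_cluster_eq_trace (ends : ι → Sym2 V) (r : ℕ) (L : ℕ → ℕ) (hL : ∀ t, 1 ≤ L t)
    (w : ℕ → ℕ → V) (e : ℕ → ℕ → ι) (u b : V) (hr : 0 < r)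
    (hw0 : ∀ t, t < r → w t 0 = u) (hwL : ∀ t, t < r → w t (L t) = b)
    (harc : ∀ t, t < r → ∀ j, 1 ≤ j → j ≤ L t → ends (e t j) = s(w t (j - 1), w t j))
    (hwinj : ∀ t, t < r → ∀ i j, i ≤ L t → j ≤ L t → w t i = w t j → i = j)
    (hcross : ∀ t t', t < r → t' < r → t ≠ t' → ∀ i j, i ≤ L t → j ≤ L t' → w t i = w t' j → (i = 0 ∧ j = 0) ∨ (i = L t ∧ j = L t'))
    (E : Finset ι) (hE : ∀ i, i ∈ E → ∃ t, t < r ∧ ∃ j, 1 ≤ j ∧ j ≤ L t ∧ e t j = i)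
    (Et : ℕ → Finset (ℕ × ℕ)) (hEt : ∀ n p, p ∈ Et n ↔ p.1 < n ∧ 1 ≤ p.2 ∧ p.2 ≤ L p.1)
    (θ : ℕ → Finset (ℕ × ℕ) → Finset ℕ) (hθ : ∀ t ω k, k ∈ θ t ω ↔ (t, k) ∈ ω)
    (D : ℕ → Finset ℕ → Finset ℕ) (hD : ∀ t η, D t η = (Icc 1 (L t - 1)).filter (fun k => ¬ (k ∈ η ↔ k + 1 ∈ η)))
    (ri ra rj rb : ℕ → Finset ℕ → ℕ)
    (hri : ∀ t η, ri t η = if 1 ∈ η then (if h : (D t η).Nonempty then (D t η).min' h else L t) else 0)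
    (hra : ∀ t η, ra t η = if 1 ∈ η then 0 else (if h : (D t η).Nonempty then (D t η).min' h else L t))
    (hrj : ∀ t η, rj t η = if L t ∈ η then (if h : (D t η).Nonempty then L t - (D t η).max' h else L t) else 0)
    (hrb : ∀ t η, rb t η = if L t ∈ η then 0 else (if h : (D t η).Nonempty then L t - (D t η).max' h else L t))
    (TX : Bool → ℕ → Finset (ℕ × ℕ) → Finset (ℕ × ℕ))
    (hTX : ∀ g n ω, TX g n ω = (range n).biUnion (fun t => (Icc 0 (ri t (θ t ω)) ∪
      (if (g = true ∨ ∃ s, s < n ∧ ri s (θ s ω) = L s) then Icc (L t - rj t (θ t ω)) (L t) else ∅)).image (Prod.mk t)))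
    (ω : Finset ι) (hω : ω ⊆ E) (ωt : Finset (ℕ × ℕ)) (hωt : ∀ p, p ∈ ωt ↔ p ∈ Et r ∧ e p.1 p.2 ∈ ω) (v : V) :
    v ∈ openCluster (ends '' (↑ω : Set ι)) u ↔ ∃ p ∈ TX false r ωt, w p.1 p.2 = v := by
  have hrun := fun t ht j hj => hubB_cluster_run_iff L hL r e Et hEt θ hθ D hD ri rj hri hrj ω ωt hωt t ht j hj
  have hle : ∀ t η, ri t η ≤ L t ∧ rj t η ≤ L t := fun t η =>
    let h4 := hubB_runs_le (L t) (D t) (hD t) (ri t) (ra t) (rj t) (rb t) (hri t) (hra t) (hrj t) (hrb t) η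
    ⟨h4.1, h4.2.2.1⟩
  -- a thread is fully red iff ri = L
  have hfull : ∀ t, t < r → ((∀ j', 1 ≤ j' → j' ≤ L t → e t j' ∈ ω) ↔ ri t (θ t ωt) = L t) := by
    intro t ht
    rw [(hrun t ht (L t) (le_refl _)).1]
    constructor
    · exact fun h => le_antisymm (hle t _).1 h
    · exact fun h => h.ge
  have hmemTX := hubB_mem_trace L θ ri rj TX hTX false r ωt
  constructor
  · intro hv
    by_cases hsat : ∃ s, s < r ∧ ri s (θ s ωt) = L s
    · -- some thread fully red: the general trace
      have h := bundle_cluster_subset_runs ends r L w e u b hw0 hwL harc hwinj hcross E hE ω hω hv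
      rcases h with h0 | hb | ⟨t, ht, j, hj1, hjL, rfl, hruns⟩
      · refine ⟨(0, 0), ?_, by rw [hw0 0 hr]; exact h0.symm⟩
        rw [hmemTX]; exact ⟨hr, Or.inl (Nat.zero_le _)⟩
      · obtain ⟨s, hs, hfs⟩ := hsat
        refine ⟨(s, L s), ?_, by rw [hwL s hs]; exact hb.symm⟩
        rw [hmemTX]; exact ⟨hs, Or.inl hfs.ge⟩
      · rcases hruns with hpre | hsuf
        · refine ⟨(t, j), ?_, rfl⟩
          rw [hmemTX]; exact ⟨ht, Or.inl (((hrun t ht j (le_of_lt hjL)).1).mp hpre)⟩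
        · refine ⟨(t, j), ?_, rfl⟩
          rw [hmemTX]
          exact ⟨ht, Or.inr ⟨Or.inr hsat, ((hrun t ht j (le_of_lt hjL)).2).mp hsuf, le_of_lt hjL⟩⟩
    · -- no fully red thread: the prefix trace
      have hnf : ∀ t, t < r → ∃ j, 1 ≤ j ∧ j ≤ L t ∧ e t j ∉ ω := by
        intro t ht
        by_contra hall
        push Not at hall
        exact hsat ⟨t, ht, (hfull t ht).mp fun j' h1 h2 => hall j' h1 h2⟩
      have h := bundle_cluster_subset_prefix ends r L w e u hw0 harc hwinj hcross E hE ω hω hnf hv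
      rcases h with h0 | ⟨t, ht, j, hj1, hjL, rfl, hpre⟩
      · refine ⟨(0, 0), ?_, by rw [hw0 0 hr]; exact h0.symm⟩
        rw [hmemTX]; exact ⟨hr, Or.inl (Nat.zero_le _)⟩
      · refine ⟨(t, j), ?_, rfl⟩
        rw [hmemTX]; exact ⟨ht, Or.inl (((hrun t ht j (le_of_lt hjL)).1).mp hpre)⟩
  · rintro ⟨p, hp, rfl⟩
    rw [hmemTX] at hp
    obtain ⟨hp1, hp2⟩ := hp
    rcases hp2 with hle' | ⟨hflag, h1, h2⟩
    · have hjL : p.2 ≤ L p.1 := le_trans hle' (hle p.1 _).1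
      exact bundle_prefix_mem_cluster ends r L w e u hw0 harc ω p.1 hp1 p.2 hjL (((hrun p.1 hp1 p.2 hjL).1).mpr hle')
    · rcases hflag with hff | ⟨s, hs, hfs⟩
      · exact absurd hff Bool.false_ne_true
      · have hbmem : b ∈ openCluster (ends '' (↑ω : Set ι)) u :=
          bundle_b_mem_cluster_of_full ends r L w e u b hw0 hwL harc ω s hs ((hfull s hs).mpr hfs)
        exact bundle_suffix_mem_cluster ends r L w e u b hwL harc ω hbmem p.1 hp1 p.2 h2 (((hrun p.1 hp1 p.2 h2).2).mpr h1)

open Classical in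
/-- **The hub `b` in the red cluster ⟺ some thread saturated in the trace.** [folklore] -/
theorem hubB_cluster_b_mem_iff (ends : ι → Sym2 V) (r : ℕ) (L : ℕ → ℕ) (hL : ∀ t, 1 ≤ L t)
    (w : ℕ → ℕ → V) (e : ℕ → ℕ → ι) (u b : V) (hr : 0 < r)
    (hw0 : ∀ t, t < r → w t 0 = u) (hwL : ∀ t, t < r → w t (L t) = b)
    (harc : ∀ t, t < r → ∀ j, 1 ≤ j → j ≤ L t → ends (e t j) = s(w t (j - 1), w t j))
    (hwinj : ∀ t, t < r → ∀ i j, i ≤ L t → j ≤ L t → w t i = w t j → i = j)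
    (hcross : ∀ t t', t < r → t' < r → t ≠ t' → ∀ i j, i ≤ L t → j ≤ L t' → w t i = w t' j → (i = 0 ∧ j = 0) ∨ (i = L t ∧ j = L t'))
    (E : Finset ι) (hE : ∀ i, i ∈ E → ∃ t, t < r ∧ ∃ j, 1 ≤ j ∧ j ≤ L t ∧ e t j = i)
    (Et : ℕ → Finset (ℕ × ℕ)) (hEt : ∀ n p, p ∈ Et n ↔ p.1 < n ∧ 1 ≤ p.2 ∧ p.2 ≤ L p.1)
    (θ : ℕ → Finset (ℕ × ℕ) → Finset ℕ) (hθ : ∀ t ω k, k ∈ θ t ω ↔ (t, k) ∈ ω)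
    (D : ℕ → Finset ℕ → Finset ℕ) (hD : ∀ t η, D t η = (Icc 1 (L t - 1)).filter (fun k => ¬ (k ∈ η ↔ k + 1 ∈ η)))
    (ri ra rj rb : ℕ → Finset ℕ → ℕ)
    (hri : ∀ t η, ri t η = if 1 ∈ η then (if h : (D t η).Nonempty then (D t η).min' h else L t) else 0)
    (hra : ∀ t η, ra t η = if 1 ∈ η then 0 else (if h : (D t η).Nonempty then (D t η).min' h else L t))
    (hrj : ∀ t η, rj t η = if L t ∈ η then (if h : (D t η).Nonempty then L t - (D t η).max' h else L t) else 0)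
    (hrb : ∀ t η, rb t η = if L t ∈ η then 0 else (if h : (D t η).Nonempty then L t - (D t η).max' h else L t))
    (TX : Bool → ℕ → Finset (ℕ × ℕ) → Finset (ℕ × ℕ))
    (hTX : ∀ g n ω, TX g n ω = (range n).biUnion (fun t => (Icc 0 (ri t (θ t ω)) ∪
      (if (g = true ∨ ∃ s, s < n ∧ ri s (θ s ω) = L s) then Icc (L t - rj t (θ t ω)) (L t) else ∅)).image (Prod.mk t)))
    (ω : Finset ι) (hω : ω ⊆ E) (ωt : Finset (ℕ × ℕ)) (hωt : ∀ p, p ∈ ωt ↔ p ∈ Et r ∧ e p.1 p.2 ∈ ω) :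
    b ∈ openCluster (ends '' (↑ω : Set ι)) u ↔ ∃ t, t < r ∧ (t, L t) ∈ TX false r ωt := by
  rw [hubB_cluster_eq_trace ends r L hL w e u b hr hw0 hwL harc hwinj hcross E hE Et hEt θ hθ D hD ri ra rj rb hri hra hrj hrb TX hTX ω hω ωt hωt b]
  have hmemTX := hubB_mem_trace L θ ri rj TX hTX false r ωt
  have hle : ∀ t η, ri t η ≤ L t := fun t η =>
    (hubB_runs_le (L t) (D t) (hD t) (ri t) (ra t) (rj t) (rb t) (hri t) (hra t) (hrj t) (hrb t) η).1
  constructor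
  · rintro ⟨p, hp, hpb⟩
    have hp' := hp
    rw [hmemTX] at hp'
    have hp1 := hp'.1
    have hp2L : p.2 ≤ L p.1 := by
      rcases hp'.2 with h | ⟨_, _, h⟩
      · exact le_trans h (hle _ _)
      · exact h
    have : p.2 = L p.1 := hwinj p.1 hp1 p.2 (L p.1) hp2L (le_refl _) (by rw [hpb, hwL p.1 hp1])
    refine ⟨p.1, hp1, ?_⟩
    have hpe : p = (p.1, L p.1) := by rw [← this]
    rw [← hpe]; exact hp
  · rintro ⟨t, ht, hmem⟩
    exact ⟨(t, L t), hmem, hwL t ht⟩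

open Classical in
/-- **THEOREM (HE pure lemma in cluster language, every bundle, all monotone 0/1 levels, all up-sets)** — module docstring. [folklore] -/
theorem bundle_HEpure_cluster (ends : ι → Sym2 V) (r : ℕ) (L : ℕ → ℕ) (hL : ∀ t, 1 ≤ L t)
    (w : ℕ → ℕ → V) (e : ℕ → ℕ → ι) (u b : V) (hr : 0 < r)
    (hw0 : ∀ t, t < r → w t 0 = u) (hwL : ∀ t, t < r → w t (L t) = b)
    (harc : ∀ t, t < r → ∀ j, 1 ≤ j → j ≤ L t → ends (e t j) = s(w t (j - 1), w t j))
    (hwinj : ∀ t, t < r → ∀ i j, i ≤ L t → j ≤ L t → w t i = w t j → i = j)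
    (hcross : ∀ t t', t < r → t' < r → t ≠ t' → ∀ i j, i ≤ L t → j ≤ L t' → w t i = w t' j → (i = 0 ∧ j = 0) ∨ (i = L t ∧ j = L t'))
    (E : Finset ι) (hE : ∀ i, i ∈ E → ∃ t, t < r ∧ ∃ j, 1 ≤ j ∧ j ≤ L t ∧ e t j = i)
    (heE : ∀ t, t < r → ∀ k, 1 ≤ k → k ≤ L t → e t k ∈ E)
    (heinj : ∀ p q : ℕ × ℕ, p.1 < r → 1 ≤ p.2 → p.2 ≤ L p.1 → q.1 < r → 1 ≤ q.2 → q.2 ≤ L q.1 → e p.1 p.2 = e q.1 q.2 → p = q)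
    (Et : ℕ → Finset (ℕ × ℕ)) (hEt : ∀ n p, p ∈ Et n ↔ p.1 < n ∧ 1 ≤ p.2 ∧ p.2 ≤ L p.1)
    (θ : ℕ → Finset (ℕ × ℕ) → Finset ℕ) (hθ : ∀ t ω k, k ∈ θ t ω ↔ (t, k) ∈ ω)
    (D : ℕ → Finset ℕ → Finset ℕ) (hD : ∀ t η, D t η = (Icc 1 (L t - 1)).filter (fun k => ¬ (k ∈ η ↔ k + 1 ∈ η)))
    (ri ra rj rb : ℕ → Finset ℕ → ℕ)
    (hri : ∀ t η, ri t η = if 1 ∈ η then (if h : (D t η).Nonempty then (D t η).min' h else L t) else 0)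
    (hra : ∀ t η, ra t η = if 1 ∈ η then 0 else (if h : (D t η).Nonempty then (D t η).min' h else L t))
    (hrj : ∀ t η, rj t η = if L t ∈ η then (if h : (D t η).Nonempty then L t - (D t η).max' h else L t) else 0)
    (hrb : ∀ t η, rb t η = if L t ∈ η then 0 else (if h : (D t η).Nonempty then L t - (D t η).max' h else L t))
    (TX TY : Bool → ℕ → Finset (ℕ × ℕ) → Finset (ℕ × ℕ))
    (hTX : ∀ g n ω, TX g n ω = (range n).biUnion (fun t => (Icc 0 (ri t (θ t ω)) ∪
      (if (g = true ∨ ∃ s, s < n ∧ ri s (θ s ω) = L s) then Icc (L t - rj t (θ t ω)) (L t) else ∅)).image (Prod.mk t)))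
    (hTY : ∀ g n ω, TY g n ω = (range n).biUnion (fun t => (Icc 0 (ra t (θ t ω)) ∪
      (if (g = true ∨ ∃ s, s < n ∧ ra s (θ s ω) = L s) then Icc (L t - rb t (θ t ω)) (L t) else ∅)).image (Prod.mk t)))
    (ha hb ka kb : Set V → Prop)
    (mha : ∀ S T : Set V, S ⊆ T → ha S → ha T) (mhb : ∀ S T : Set V, S ⊆ T → hb S → hb T)
    (mka : ∀ S T : Set V, S ⊆ T → ka S → ka T) (mkb : ∀ S T : Set V, S ⊆ T → kb S → kb T)
    (𝒱 : Finset ι → Prop) (hV : ∀ s t : Finset ι, s ⊆ t → t ⊆ E → 𝒱 s → 𝒱 t) :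
    (E.powerset.filter (fun ω => 𝒱 ω ∧
        (b ∉ openCluster (ends '' (↑ω : Set ι)) u ∧ b ∈ openCluster (ends '' (↑(E \ ω) : Set ι)) u) ∧
        ha (openCluster (ends '' (↑ω : Set ι)) u) ∧ ¬ hb (openCluster (ends '' (↑(E \ ω) : Set ι)) u) ∧
        kb (openCluster (ends '' (↑(E \ ω) : Set ι)) u) ∧ ¬ ka (openCluster (ends '' (↑ω : Set ι)) u))).card ≤
    (E.powerset.filter (fun ω => 𝒱 ω ∧
        (b ∈ openCluster (ends '' (↑ω : Set ι)) u ∧ b ∉ openCluster (ends '' (↑(E \ ω) : Set ι)) u) ∧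
        ha (openCluster (ends '' (↑ω : Set ι)) u) ∧ ¬ hb (openCluster (ends '' (↑(E \ ω) : Set ι)) u) ∧
        kb (openCluster (ends '' (↑ω : Set ι)) u) ∧ ¬ ka (openCluster (ends '' (↑(E \ ω) : Set ι)) u))).card := by
  -- the index word map Ψ and the image sets
  obtain ⟨Ψ, hΨ⟩ : ∃ Ψ : Finset ι → Finset (ℕ × ℕ), ∀ ω p, p ∈ Ψ ω ↔ p ∈ Et r ∧ e p.1 p.2 ∈ ω :=
    ⟨fun ω => (Et r).filter (fun p => e p.1 p.2 ∈ ω), fun ω p => by rw [Finset.mem_filter]⟩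
  obtain ⟨Img, hImg⟩ : ∃ Img : Finset (ℕ × ℕ) → Set V, ∀ S, Img S = {v | ∃ p ∈ S, w p.1 p.2 = v} := ⟨_, fun _ => rfl⟩
  have hImg_mono : ∀ S T : Finset (ℕ × ℕ), S ⊆ T → Img S ⊆ Img T := by
    intro S T hST v hv
    rw [hImg] at hv ⊢
    obtain ⟨p, hp, hpv⟩ := hv
    exact ⟨p, hST hp, hpv⟩
  -- complements: Ψ (E \ ω) = Et r \ Ψ ω
  have hΨc : ∀ ω, Ψ (E \ ω) = Et r \ Ψ ω := by
    intro ω; ext p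
    rw [hΨ, Finset.mem_sdiff, Finset.mem_sdiff, hΨ]
    constructor
    · rintro ⟨h1, _, h3⟩; exact ⟨h1, fun h => h3 h.2⟩
    · rintro ⟨h1, h2⟩
      have := (hEt r p).mp h1
      exact ⟨h1, heE p.1 this.1 p.2 this.2.1 this.2.2, fun h => h2 ⟨h1, h⟩⟩
  have hc1 : ∀ t η, t < r → ri t (Icc 1 (L t) \ η) = ra t η ∧ rj t (Icc 1 (L t) \ η) = rb t η := fun t η _ =>
    let h4 := hubB_runs_compl (L t) (hL t) (D t) (hD t) (ri t) (ra t) (rj t) (rb t) (hri t) (hra t) (hrj t) (hrb t) η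
    ⟨h4.1, h4.2.2.1⟩
  have hTYeq : ∀ ω, TX false r (Ψ (E \ ω)) = TY false r (Ψ ω) := fun ω => by
    rw [hΨc]; exact hubB_trace_compl L Et hEt θ hθ ri rj ra rb TX TY hTX hTY r hc1 false (Ψ ω)
  -- the dictionary: X = Img TX, Y = Img TY, and the hub b
  have hX : ∀ ω, ω ⊆ E → openCluster (ends '' (↑ω : Set ι)) u = Img (TX false r (Ψ ω)) := by
    intro ω hω; ext v
    rw [hubB_cluster_eq_trace ends r L hL w e u b hr hw0 hwL harc hwinj hcross E hE Et hEt θ hθ D hD ri ra rj rb hri hra hrj hrb TX hTX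
      ω hω (Ψ ω) (hΨ ω) v, hImg]
    simp only [Set.mem_setOf_eq]
  have hY : ∀ ω, openCluster (ends '' (↑(E \ ω) : Set ι)) u = Img (TY false r (Ψ ω)) := by
    intro ω; ext v
    rw [hubB_cluster_eq_trace ends r L hL w e u b hr hw0 hwL harc hwinj hcross E hE Et hEt θ hθ D hD ri ra rj rb hri hra hrj hrb TX hTX
      (E \ ω) Finset.sdiff_subset (Ψ (E \ ω)) (hΨ (E \ ω)) v, hTYeq, hImg]
    simp only [Set.mem_setOf_eq]
  have hbX : ∀ ω, ω ⊆ E → (b ∈ openCluster (ends '' (↑ω : Set ι)) u ↔ ∃ t, t < r ∧ (t, L t) ∈ TX false r (Ψ ω)) := fun ω hω =>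
    hubB_cluster_b_mem_iff ends r L hL w e u b hr hw0 hwL harc hwinj hcross E hE Et hEt θ hθ D hD ri ra rj rb hri hra hrj hrb TX hTX ω hω (Ψ ω) (hΨ ω)
  have hbY : ∀ ω, (b ∈ openCluster (ends '' (↑(E \ ω) : Set ι)) u ↔ ∃ t, t < r ∧ (t, L t) ∈ TY false r (Ψ ω)) := by
    intro ω
    rw [hubB_cluster_b_mem_iff ends r L hL w e u b hr hw0 hwL harc hwinj hcross E hE Et hEt θ hθ D hD ri ra rj rb hri hra hrj hrb TX hTX
      (E \ ω) Finset.sdiff_subset (Ψ (E \ ω)) (hΨ (E \ ω)), hTYeq]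
  -- index-level levels and predicates
  obtain ⟨bad₁', hbad₁'⟩ : ∃ bad₁' : Finset (ℕ × ℕ) → Prop, ∀ η, bad₁' η ↔
      (¬ (∃ t, t < r ∧ (t, L t) ∈ TX false r η) ∧ (∃ t, t < r ∧ (t, L t) ∈ TY false r η)) ∧
      ha (Img (TX false r η)) ∧ ¬ hb (Img (TY false r η)) ∧ kb (Img (TY false r η)) ∧ ¬ ka (Img (TX false r η)) := ⟨_, fun _ => Iff.rfl⟩
  obtain ⟨L₁', hL₁'⟩ : ∃ L₁' : Finset (ℕ × ℕ) → Prop, ∀ η, L₁' η ↔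
      ((∃ t, t < r ∧ (t, L t) ∈ TX false r η) ∧ ¬ (∃ t, t < r ∧ (t, L t) ∈ TY false r η)) ∧
      ha (Img (TX false r η)) ∧ ¬ hb (Img (TY false r η)) ∧ kb (Img (TX false r η)) ∧ ¬ ka (Img (TY false r η)) := ⟨_, fun _ => Iff.rfl⟩
  -- Ψ is injective on colourings ⊆ E and monotone
  have hΨinj : ∀ ω₁ ω₂ : Finset ι, ω₁ ⊆ E → ω₂ ⊆ E → Ψ ω₁ = Ψ ω₂ → ω₁ = ω₂ := by
    have key : ∀ ω₁ ω₂ : Finset ι, ω₁ ⊆ E → Ψ ω₁ = Ψ ω₂ → ω₁ ⊆ ω₂ := by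
      intro ω₁ ω₂ h₁ h i hi
      obtain ⟨t, ht, j, hj1, hjL, rfl⟩ := hE i (h₁ hi)
      have : (t, j) ∈ Ψ ω₁ := (hΨ ω₁ _).mpr ⟨(hEt r _).mpr ⟨ht, hj1, hjL⟩, hi⟩
      rw [h] at this
      exact ((hΨ ω₂ _).mp this).2
    intro ω₁ ω₂ h₁ h₂ h
    exact Finset.Subset.antisymm (key ω₁ ω₂ h₁ h) (key ω₂ ω₁ h₂ h.symm)
  -- the transported event
  have key := hubBundle_HEpure L hL Et hEt θ hθ D hD ri ra rj rb hri hra hrj hrb TX TY hTX hTY r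
    (fun S => ha (Img S)) (fun S => hb (Img S)) (fun S => ka (Img S)) (fun S => kb (Img S))
    (fun S T hST h => mha _ _ (hImg_mono S T hST) h) (fun S T hST h => mhb _ _ (hImg_mono S T hST) h)
    (fun S T hST h => mka _ _ (hImg_mono S T hST) h) (fun S T hST h => mkb _ _ (hImg_mono S T hST) h)
    bad₁' L₁' hbad₁' hL₁' ((E.powerset.filter (fun ω => 𝒱 ω)).image Ψ) ?_ ?_
  · -- translate both sides
    rw [Finset.filter_image, Finset.filter_image,
      Finset.card_image_of_injOn (fun ω₁ h₁ ω₂ h₂ h => hΨinj ω₁ ω₂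
        (Finset.mem_powerset.mp (Finset.mem_filter.mp (Finset.mem_filter.mp (Finset.mem_coe.mp h₁)).1).1)
        (Finset.mem_powerset.mp (Finset.mem_filter.mp (Finset.mem_filter.mp (Finset.mem_coe.mp h₂)).1).1) h),
      Finset.card_image_of_injOn (fun ω₁ h₁ ω₂ h₂ h => hΨinj ω₁ ω₂
        (Finset.mem_powerset.mp (Finset.mem_filter.mp (Finset.mem_filter.mp (Finset.mem_coe.mp h₁)).1).1)
        (Finset.mem_powerset.mp (Finset.mem_filter.mp (Finset.mem_filter.mp (Finset.mem_coe.mp h₂)).1).1) h),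
      Finset.filter_filter, Finset.filter_filter] at key
    have e1 : E.powerset.filter (fun ω => 𝒱 ω ∧
        (b ∉ openCluster (ends '' (↑ω : Set ι)) u ∧ b ∈ openCluster (ends '' (↑(E \ ω) : Set ι)) u) ∧
        ha (openCluster (ends '' (↑ω : Set ι)) u) ∧ ¬ hb (openCluster (ends '' (↑(E \ ω) : Set ι)) u) ∧
        kb (openCluster (ends '' (↑(E \ ω) : Set ι)) u) ∧ ¬ ka (openCluster (ends '' (↑ω : Set ι)) u)) =
        E.powerset.filter (fun ω => 𝒱 ω ∧ (bad₁' ∘ Ψ) ω) := by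
      refine Finset.filter_congr fun ω hω => ?_
      have hωE := Finset.mem_powerset.mp hω
      rw [Function.comp_apply, hbad₁', hbX ω hωE, hbY ω, hX ω hωE, hY ω]
    have e2 : E.powerset.filter (fun ω => 𝒱 ω ∧
        (b ∈ openCluster (ends '' (↑ω : Set ι)) u ∧ b ∉ openCluster (ends '' (↑(E \ ω) : Set ι)) u) ∧
        ha (openCluster (ends '' (↑ω : Set ι)) u) ∧ ¬ hb (openCluster (ends '' (↑(E \ ω) : Set ι)) u) ∧
        kb (openCluster (ends '' (↑ω : Set ι)) u) ∧ ¬ ka (openCluster (ends '' (↑(E \ ω) : Set ι)) u)) =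
        E.powerset.filter (fun ω => 𝒱 ω ∧ (L₁' ∘ Ψ) ω) := by
      refine Finset.filter_congr fun ω hω => ?_
      have hωE := Finset.mem_powerset.mp hω
      rw [Function.comp_apply, hL₁', hbX ω hωE, hbY ω, hX ω hωE, hY ω]
    rw [e1, e2]
    exact key
  · intro η hη
    obtain ⟨ω, _, rfl⟩ := Finset.mem_image.mp hη
    intro p hp
    exact ((hΨ ω p).mp hp).1
  · intro η hη η' hsub hη'
    obtain ⟨ω, hω, rfl⟩ := Finset.mem_image.mp hη
    obtain ⟨hωE, hω𝒱⟩ := Finset.mem_filter.mp hω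
    rw [Finset.mem_powerset] at hωE
    -- η' = Ψ ω' with ω' = the edges of η'
    have hω'E : η'.image (fun p => e p.1 p.2) ⊆ E := by
      intro i hi
      obtain ⟨p, hp, rfl⟩ := Finset.mem_image.mp hi
      have := (hEt r p).mp (hη' hp)
      exact heE p.1 this.1 p.2 this.2.1 this.2.2
    have hΨω' : Ψ (η'.image (fun p => e p.1 p.2)) = η' := by
      ext p
      rw [hΨ]
      constructor
      · rintro ⟨hp, hpe⟩
        obtain ⟨q, hq, hqe⟩ := Finset.mem_image.mp hpe
        have hp' := (hEt r p).mp hp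
        have hq' := (hEt r q).mp (hη' hq)
        have : q = p := heinj q p hq'.1 hq'.2.1 hq'.2.2 hp'.1 hp'.2.1 hp'.2.2 hqe
        rw [← this]; exact hq
      · intro hp
        exact ⟨hη' hp, Finset.mem_image.mpr ⟨p, hp, rfl⟩⟩
    have hωω' : ω ⊆ η'.image (fun p => e p.1 p.2) := by
      intro i hi
      obtain ⟨t, ht, j, hj1, hjL, rfl⟩ := hE i (hωE hi)
      have : (t, j) ∈ Ψ ω := (hΨ ω _).mpr ⟨(hEt r _).mpr ⟨ht, hj1, hjL⟩, hi⟩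
      exact Finset.mem_image.mpr ⟨(t, j), hsub this, rfl⟩
    rw [← hΨω']
    exact Finset.mem_image.mpr ⟨_, Finset.mem_filter.mpr ⟨Finset.mem_powerset.mpr hω'E, hV ω _ hωω' hω'E hω𝒱⟩, rfl⟩

end Coefficientwise

end Summit.CriticalPhenomena.PercolationContinuityZ3.Theorems
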